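import Summits.AtomisticToContinuum.HydrodynamicLimit.Theorems.RelayRaceLocalityLightConeInLawSVCCountFamilyEnvelope

/-!
# Count families on `ℕ`: the local central-limit lower bound

Helper file (`--supports stmt-AtomisticToContinuum-12500`) of the line `susceptibility-variance-continuity`
of the crux `LightConeInLaw`, for the stub `stub_countLCLT` (part (c) in abstract form), concluding the
series `…SVCCountFamilyMoments` / `…Variance` / `…Envelope`. Pure discrete analysis.

`countFamily_lclt`: there are universal `ν₀, c > 0` such that every count family
`(n+1) p(n+1) = ν g(n) p(n)` (`Σ p = 1`, `p(0) > 0`, `0 ≤ g ≤ 1`) with `g ≥ 1 - λ ≥ 1/2` and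
`|g(n+1) - g(n)| ≤ D` on `[0, G]`, `ν D ≤ 1/8`, `G ≥ 4ν + 3`, `ν ≥ ν₀`, satisfies `√ν · p(n) ≥ c` at every
`n` with `|n - mean| ≤ 1`. Proof: let `m` maximise `p` on `[0, G]`. (i) `m ≥ ν/2 - 1` (below `(1-λ)ν` the
weights increase). (ii) By Chebyshev at scale `3⌈√ν⌉` (variance `≤ 2ν`, `countFamily_variance`) and
pigeonhole (`exists_heavy_near_mean`), `p(m) ≥ 1/(10⌈√ν⌉)`. (iii) The curvature of `log p` is `≥ -10/ν` on
`[ν/4, G)` (`log_second_diff_ge`), so `p ≥ p(m) e^{-20}` on the `⌈√ν⌉` points below `m` (`concave_down`):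
a block of mass `≥ e^{-20}/10`, which by Chebyshev at scale `K⌈√ν⌉`, `K = ⌈5e^{10}⌉`, must meet the
`K⌈√ν⌉`-neighbourhood of the mean; hence `|m - mean| ≤ (K+1)⌈√ν⌉`. (iv) The envelopes from `m`
(`concave_down`, `concave_up`) then give `p(n) ≥ p(m) e^{-40(K+1)²}` at `|n - mean| ≤ 1`.
-/

namespace Summit.AtomisticToContinuum.HydrodynamicLimit.Theorems.LightConeInLawSVC.CountLCLT

open scoped BigOperators
open Finset

noncomputable section

/-- From a lower bound on `log x - log y` to a multiplicative lower bound. [folklore] -/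
theorem le_of_log_sub_ge {x y E : ℝ} (hx : 0 < x) (hy : 0 < y) (h : -E ≤ Real.log x - Real.log y) :
    y * Real.exp (-E) ≤ x := by
  have h1 : Real.log y + -E ≤ Real.log x := by linarith
  have h2 := Real.exp_le_exp.mpr h1
  rwa [Real.exp_add, Real.exp_log hy, Real.exp_log hx] at h2

/-- A natural number that is `< N + 1` as a real number is `≤ N`. [folklore] -/
theorem nat_le_of_lt_add_one {j N : ℕ} (h : (j : ℝ) < (N : ℝ) + 1) : j ≤ N := by
  have h' : j < N + 1 := by exact_mod_cast h
  omega

set_option maxHeartbeats 400000 in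
/-- **COUNT FAMILIES: THE LOCAL CENTRAL-LIMIT LOWER BOUND** (registered helper `countFamily_lclt` of the line
`susceptibility-variance-continuity`; part (c) of `stub_countLCLT` in abstract form). There are universal
constants `ν₀, c > 0` such that for every probability weight `p` on `ℕ` with `p(0) > 0`,
`(n+1) p(n+1) = ν g(n) p(n)`, `0 ≤ g ≤ 1`, `g ≥ 1 - λ ≥ 1/2` and `|g(n+1) - g(n)| ≤ D` on `[0, G]`,
`ν ≥ ν₀`, `G ≥ 4ν + 3`, `ν D ≤ 1/8`: `c ≤ √ν · p(n)` whenever `|n - Σ p k k| ≤ 1`. [folklore] -/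
theorem countFamily_lclt :
    ∃ ν₀ : ℝ, 0 < ν₀ ∧ ∃ c : ℝ, 0 < c ∧
      ∀ (p g : ℕ → ℝ) (ν lam D : ℝ) (G : ℕ),
        (∀ n, 0 ≤ p n) → HasSum p 1 → 0 < p 0 → (∀ n, p (n + 1) * ((n : ℝ) + 1) = ν * g n * p n) →
        (∀ n, 0 ≤ g n) → (∀ n, g n ≤ 1) → ν₀ ≤ ν → 4 * ν + 3 ≤ (G : ℝ) →
        lam ≤ 1 / 2 → (∀ n, n ≤ G → 1 - lam ≤ g n) →
        0 ≤ D → (∀ n, n < G → |g (n + 1) - g n| ≤ D) → ν * D ≤ 1 / 8 →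
        ∀ n : ℕ, |(n : ℝ) - ∑' k, p k * (k : ℝ)| ≤ 1 → c ≤ Real.sqrt ν * p n := by
  -- the universal constants
  set K : ℕ := ⌈5 * Real.exp 10⌉₊ with hKdef
  have hK : 5 * Real.exp 10 ≤ K := Nat.le_ceil _
  have hK1 : (1 : ℝ) ≤ K := le_trans (by have := Real.add_one_le_exp (10 : ℝ); linarith) hK
  set E : ℝ := 40 * ((K : ℝ) + 1) ^ 2 with hEdef
  refine ⟨36, by norm_num, Real.exp (-E) / 20, by positivity, ?_⟩
  intro p g ν lam D G hp hsum hp0 hrat hg0 hg1 hν36 hG hlam hgl hD0 hD hνD n hn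
  have hν : 0 < ν := by linarith
  have hν1 : 1 ≤ ν := by linarith
  have hν32 : 32 ≤ ν := by linarith
  have hlam' : 1 / 2 ≤ 1 - lam := by linarith
  have hgl' : ∀ k, k ≤ G → 1 / 2 ≤ g k := fun k hk => le_trans hlam' (hgl k hk)
  have hpos : ∀ k, k ≤ G + 1 → 0 < p k :=
    pos_of_le hrat hν hp0 fun k hk => lt_of_lt_of_le (by norm_num) (hgl' k hk)
  -- moments
  have hvar := countFamily_variance p g ν lam D G hp hsum hrat hg0 hg1 hν32 hG hlam hgl hD0 hD hνD
  have hMle := mean_le hp hsum hrat hg0 hg1 hν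
  have hT : ∑' k, p (k + G) ≤ 2 / ν ^ 2 := tail_le_of_ge hp hsum hrat hg1 hν1 hG
  have hEg := tsum_mul_g_ge hp hsum hrat hg0 hg1 hν (by linarith : lam ≤ 1) hgl
  have hMeq := tsum_mul_nat_eq hp hrat hg1 hν
  have hfar : ∀ W : ℝ, 0 < W →
      ∑' k, p k * (if W ≤ |(k : ℝ) - ∑' j, p j * (j : ℝ)| then (1 : ℝ) else 0) ≤
        (∑' k, p k * (k : ℝ) ^ 2 - (∑' k, p k * (k : ℝ)) ^ 2) / W ^ 2 :=
    fun W hW => tsum_far_le hp hsum hrat hg1 hν hW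
  -- the mean is `≥ ν/2 - 1/ν`
  have hMge : ν / 2 - 1 / ν ≤ ∑' k, p k * (k : ℝ) := by
    rw [hMeq]
    have hT0 : 0 ≤ ∑' k, p (k + G) := tsum_nonneg fun k => hp _
    have h0 : 0 ≤ 1 - 2 / ν ^ 2 := by
      have h2 : 2 / ν ^ 2 ≤ 1 := by rw [div_le_one (by positivity)]; nlinarith
      linarith
    have h1 : (1 / 2) * (1 - 2 / ν ^ 2) ≤ (1 - lam) * (1 - ∑' k, p (k + G)) :=
      mul_le_mul hlam' (by linarith) h0 (by linarith)
    have h2 : ν * ((1 / 2) * (1 - 2 / ν ^ 2)) = ν / 2 - 1 / ν := by field_simp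
    calc ν / 2 - 1 / ν = ν * ((1 / 2) * (1 - 2 / ν ^ 2)) := h2.symm
      _ ≤ ν * ∑' k, p k * g k := mul_le_mul_of_nonneg_left (h1.trans hEg) hν.le
  -- abstract the mean and the second moment
  generalize hM : ∑' k, p k * (k : ℝ) = M at hvar hMle hfar hMge hn
  generalize hS : ∑' k, p k * (k : ℝ) ^ 2 = S at hvar hfar
  obtain ⟨_, hVle⟩ := hvar
  have hinv : 1 / ν ≤ 1 := by rw [div_le_one hν]; exact hν1
  -- the scale `s = ⌈√ν⌉₊`
  set s : ℕ := ⌈Real.sqrt ν⌉₊ with hsdef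
  have hsq1 : 1 ≤ Real.sqrt ν := Real.one_le_sqrt.mpr hν1
  have hs1 : Real.sqrt ν ≤ s := Nat.le_ceil _
  have hs2 : (s : ℝ) < Real.sqrt ν + 1 := Nat.ceil_lt_add_one (Real.sqrt_nonneg ν)
  have hs3 : (1 : ℝ) ≤ s := hsq1.trans hs1
  have hsnat : 1 ≤ s := by exact_mod_cast hs3
  have hνs : ν ≤ (s : ℝ) ^ 2 := by
    calc ν = Real.sqrt ν ^ 2 := (Real.sq_sqrt hν.le).symm
      _ ≤ (s : ℝ) ^ 2 := pow_le_pow_left₀ (Real.sqrt_nonneg ν) hs1 2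
  have hs4 : (s : ℝ) ≤ 2 * Real.sqrt ν := by linarith
  have hs5 : (s : ℝ) ^ 2 ≤ 4 * ν := by
    calc (s : ℝ) ^ 2 ≤ (2 * Real.sqrt ν) ^ 2 := pow_le_pow_left₀ (by positivity) hs4 2
      _ = 4 * ν := by rw [mul_pow, Real.sq_sqrt hν.le]; ring
  have hsq6 : 6 ≤ Real.sqrt ν := by
    rw [Real.le_sqrt (by norm_num) hν.le]; linarith
  have hsν6 : 6 * Real.sqrt ν ≤ ν := by
    calc 6 * Real.sqrt ν ≤ Real.sqrt ν * Real.sqrt ν :=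
          mul_le_mul_of_nonneg_right hsq6 (Real.sqrt_nonneg ν)
      _ = ν := Real.mul_self_sqrt hν.le
  -- (ii) a heavy point `n₁` near the mean, at scale `w = 3s`
  have hfar1 : ∑' k, p k * (if ((3 * s : ℕ) : ℝ) ≤ |(k : ℝ) - M| then (1 : ℝ) else 0) ≤ 1 / 4 := by
    have h := hfar ((3 * s : ℕ) : ℝ) (by positivity)
    refine h.trans ?_
    rw [div_le_iff₀ (by positivity)]
    push_cast
    have : (1 : ℝ) / 4 * (3 * (s : ℝ)) ^ 2 = 9 / 4 * (s : ℝ) ^ 2 := by ring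
    have h0 : (0 : ℝ) ≤ (s : ℝ) ^ 2 := sq_nonneg _
    linarith only [hVle, hνs, this, h0]
  have hheavy := exists_heavy_near_mean hp hsum hrat hg1 hν (w := 3 * s) (by omega)
  rw [hM] at hheavy
  obtain ⟨n₁, hn₁M, hn₁p⟩ := hheavy hfar1
  push_cast at hn₁M hn₁p
  have hδ : 1 / (10 * (s : ℝ)) ≤ p n₁ := by
    refine le_trans ?_ hn₁p
    rw [div_le_div_iff₀ (by positivity) (by positivity)]
    linarith only [hs3]
  have hn₁G : n₁ ≤ G := by
    have h1 := (abs_lt.mp hn₁M).2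
    exact nat_le_of_lt_add_one (by linarith only [h1, hMle, hs2, hsν6, hG, hν])
  -- the maximiser `m` of `p` on `[0, G]`
  obtain ⟨m, hmG, hmax⟩ := exists_max_image (range (G + 1)) p ⟨0, by simp⟩
  have hmG' : m ≤ G := Nat.lt_succ_iff.mp (mem_range.mp hmG)
  have hmax' : ∀ k, k ≤ G → p k ≤ p m := fun k hk => hmax k (mem_range.mpr (Nat.lt_succ_of_le hk))
  have hpm : 1 / (10 * (s : ℝ)) ≤ p m := hδ.trans (hmax' n₁ hn₁G)
  have hpm0 : 0 < p m := lt_of_lt_of_le (by positivity) hpm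
  -- (i) `m + 1 ≥ ν/2`
  have hmlo : ν / 2 ≤ (m : ℝ) + 1 := by
    by_contra hcon
    push Not at hcon
    have hm1G : m + 1 ≤ G := nat_le_of_lt_add_one (by push_cast; linarith only [hcon, hG, hν])
    have h1 := hmax' (m + 1) hm1G
    have h2 := hrat m
    have h3 : ν * (1 / 2) * p m ≤ ν * g m * p m := by
      have := hgl' m hmG'; gcongr
    have h4 : p (m + 1) * ((m : ℝ) + 1) ≤ p m * ((m : ℝ) + 1) :=
      mul_le_mul_of_nonneg_right h1 (by positivity)
    have h5 : p m * ((m : ℝ) + 1) < p m * (ν / 2) := mul_lt_mul_of_pos_left hcon hpm0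
    linarith only [h2, h3, h4, h5]
  -- write `m = b + 1`; `p(m+1) ≤ p(m)` and `p(m-1) ≤ p(m)`
  obtain ⟨b, rfl⟩ : ∃ b, m = b + 1 := ⟨m - 1, by
    have : (1 : ℝ) ≤ m := by linarith only [hmlo, hν36]
    have : 1 ≤ m := by exact_mod_cast this
    omega⟩
  have hmlo' : ν / 2 ≤ (b : ℝ) + 1 + 1 := by push_cast at hmlo; linarith only [hmlo]
  have htop : p (b + 1 + 1) ≤ p (b + 1) := by
    rcases Nat.lt_or_ge (b + 1) G with hlt | hge
    · exact hmax' (b + 1 + 1) hlt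
    · have hbG : b + 1 = G := le_antisymm hmG' hge
      have h2 := hrat (b + 1)
      have hG1 : ν ≤ (((b + 1 : ℕ) : ℝ)) + 1 := by rw [hbG]; linarith only [hG, hν]
      have h3 : ν * g (b + 1) * p (b + 1) ≤ ((((b + 1 : ℕ) : ℝ)) + 1) * p (b + 1) := by
        refine mul_le_mul_of_nonneg_right ?_ (hp _)
        calc ν * g (b + 1) ≤ ν * 1 := mul_le_mul_of_nonneg_left (hg1 _) hν.le
          _ ≤ ((b + 1 : ℕ) : ℝ) + 1 := by linarith only [hG1]
      have h4 : p (b + 1 + 1) * (((b + 1 : ℕ) : ℝ) + 1) ≤ p (b + 1) * (((b + 1 : ℕ) : ℝ) + 1) := by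
        rw [h2]; linarith only [h3]
      exact le_of_mul_le_mul_right h4 (by positivity)
  have hbot : p b ≤ p (b + 1) := hmax' b (by omega)
  -- (iii) curvature of `log p` on `[A, G)`, `A = ⌈ν/4⌉₊`
  set A : ℕ := ⌈ν / 4⌉₊ with hAdef
  have hA1 : ν / 4 ≤ A := Nat.le_ceil _
  have hA2 : (A : ℝ) < ν / 4 + 1 := Nat.ceil_lt_add_one (by positivity)
  have hc : ∀ k, A ≤ k → k < G →
      -(10 / ν) ≤ Real.log (p (k + 2)) - 2 * Real.log (p (k + 1)) + Real.log (p k) := by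
    intro k hk hkG
    refine log_second_diff_ge hrat hν32 hgl' hD hνD hpos ?_ hkG
    have : (A : ℝ) ≤ k := by exact_mod_cast hk
    linarith only [this, hA1]
  have hlogtop : Real.log (p (b + 1 + 1)) - Real.log (p (b + 1)) ≤ 0 := by
    have := Real.log_le_log (hpos (b + 1 + 1) (by omega)) htop; linarith only [this]
  have hlogbot : -(0 : ℝ) ≤ Real.log (p (b + 1)) - Real.log (p b) := by
    have := Real.log_le_log (hpos b (by omega)) hbot; linarith only [this]
  have hbA : A ≤ b := by
    have : (A : ℝ) < (b : ℝ) + 1 := by linarith only [hA2, hmlo', hν36]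
    exact nat_le_of_lt_add_one this
  -- downward envelope: `log p(a) ≥ log p(m) - (10/ν) j(j+1)/2` for `a + j = m`, `A ≤ a`
  have hdown : ∀ a j : ℕ, A ≤ a → a + j = b + 1 →
      -(10 / ν * ((j : ℝ) * ((j : ℝ) + 1) / 2)) ≤ Real.log (p a) - Real.log (p (b + 1)) := by
    intro a j ha haj
    have h := concave_down (ℓ := fun k => Real.log (p k)) hc ha j 0 (by omega)
      (by simp only [haj]; exact hlogtop)
    simp only [haj, mul_zero, zero_add] at h
    linarith only [h]
  -- upward envelope
  have hup : ∀ j : ℕ, b + j ≤ G →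
      -(10 / ν * ((j : ℝ) * ((j : ℝ) + 1) / 2)) ≤ Real.log (p (b + 1 + j)) - Real.log (p (b + 1)) := by
    intro j hj
    have h := concave_up (ℓ := fun k => Real.log (p k)) hc j b 0 hbA hj hlogbot
    simp only [mul_zero, zero_add] at h
    exact h
  -- the block of `s` points below `m`: each point is `≥ p(m) e^{-20}`
  set B : Finset ℕ := Ico (b + 1 - (s - 1)) (b + 1 + 1) with hBdef
  have hsb : s - 1 ≤ b + 1 := by
    have h1 : (s : ℝ) < ((b + 1 : ℕ) : ℝ) + 1 := by push_cast; linarith only [hs2, hsν6, hmlo', hν36]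
    have h2 : s ≤ b + 1 := nat_le_of_lt_add_one h1
    omega
  have hBcard : B.card = s := by rw [hBdef, Nat.card_Ico]; omega
  have hBlow : ∀ k ∈ B, p (b + 1) * Real.exp (-20) ≤ p k := by
    intro k hk
    rw [hBdef, mem_Ico] at hk
    obtain ⟨j, hj⟩ : ∃ j, k + j = b + 1 := ⟨b + 1 - k, by omega⟩
    have hjs : j + 1 ≤ s := by omega
    have h2 : (k : ℝ) + j = (b : ℝ) + 1 := by exact_mod_cast hj
    have h3 : ((j : ℝ) + 1) ≤ s := by exact_mod_cast hjs
    have hkA : A ≤ k := by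
      have : (A : ℝ) < (k : ℝ) + 1 := by linarith only [hA2, h2, h3, hs2, hsν6, hmlo', hν36]
      exact nat_le_of_lt_add_one this
    have h := hdown k j hkA hj
    refine le_of_log_sub_ge (hpos k (by omega)) hpm0 (le_trans ?_ h)
    have hj0 : (0 : ℝ) ≤ j := Nat.cast_nonneg j
    have h5 : ((j : ℝ) + 1) ^ 2 ≤ (s : ℝ) ^ 2 := pow_le_pow_left₀ (by positivity) h3 2
    have h4 : (j : ℝ) * ((j : ℝ) + 1) / 2 ≤ (s : ℝ) ^ 2 / 2 := by
      rw [div_le_div_iff_of_pos_right (by norm_num : (0:ℝ) < 2)]; nlinarith only [h5, hj0]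
    have h6 : 10 / ν * ((j : ℝ) * ((j : ℝ) + 1) / 2) ≤ 20 := by
      calc 10 / ν * ((j : ℝ) * ((j : ℝ) + 1) / 2) ≤ 10 / ν * ((s : ℝ) ^ 2 / 2) :=
            mul_le_mul_of_nonneg_left h4 (by positivity)
        _ ≤ 10 / ν * (4 * ν / 2) := by gcongr
        _ = 20 := by rw [div_mul_eq_mul_div, div_eq_iff hν.ne']; ring
    linarith only [h6]
  have hBmass : (s : ℝ) * (p (b + 1) * Real.exp (-20)) ≤ ∑ k ∈ B, p k := by
    have h := card_nsmul_le_sum B p (p (b + 1) * Real.exp (-20)) hBlow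
    rwa [hBcard, nsmul_eq_mul] at h
  -- (iii') the block meets the `K s`-neighbourhood of the mean
  have hfar2 : ∑' k, p k * (if ((K * s : ℕ) : ℝ) ≤ |(k : ℝ) - M| then (1 : ℝ) else 0) ≤ 2 / (K : ℝ) ^ 2 := by
    have h := hfar ((K * s : ℕ) : ℝ) (by positivity)
    refine h.trans ?_
    push_cast
    rw [div_le_div_iff₀ (by positivity) (by positivity)]
    calc (S - M ^ 2) * (K : ℝ) ^ 2 ≤ (2 * (s : ℝ) ^ 2) * (K : ℝ) ^ 2 :=
          mul_le_mul_of_nonneg_right (by linarith only [hVle, hνs]) (by positivity)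
      _ = 2 * ((K : ℝ) * s) ^ 2 := by ring
  have hmeet : ∃ k ∈ B, |(k : ℝ) - M| < K * s := by
    by_contra hcon
    push Not at hcon
    have h1 : ∑ k ∈ B, p k ≤ ∑' k, p k * (if ((K * s : ℕ) : ℝ) ≤ |(k : ℝ) - M| then (1 : ℝ) else 0) :=
      sum_le_tsum_indicator hp hsum B (fun k => by split_ifs <;> norm_num) (fun k => by split_ifs <;> norm_num)
        fun k hk => by rw [if_pos (by push_cast; exact hcon k hk)]
    have h2 : Real.exp (-20) / 10 ≤ (s : ℝ) * (p (b + 1) * Real.exp (-20)) := by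
      have e1 : (s : ℝ) * (1 / (10 * s)) = 1 / 10 := by field_simp
      calc Real.exp (-20) / 10 = (s : ℝ) * (1 / (10 * s)) * Real.exp (-20) := by rw [e1]; ring
        _ ≤ (s : ℝ) * p (b + 1) * Real.exp (-20) := by gcongr
        _ = _ := by ring
    have hK2 : 25 * Real.exp 20 ≤ (K : ℝ) ^ 2 := by
      calc 25 * Real.exp 20 = (5 * Real.exp 10) ^ 2 := by
            rw [mul_pow, ← Real.exp_nat_mul]; norm_num
        _ ≤ (K : ℝ) ^ 2 := pow_le_pow_left₀ (by positivity) hK 2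
    have h3 : 2 / (K : ℝ) ^ 2 < Real.exp (-20) / 10 := by
      rw [div_lt_div_iff₀ (by positivity) (by norm_num)]
      calc (2 : ℝ) * 10 < 25 := by norm_num
        _ = Real.exp (-20) * (25 * Real.exp 20) := by rw [mul_left_comm, ← Real.exp_add]; norm_num
        _ ≤ Real.exp (-20) * (K : ℝ) ^ 2 := mul_le_mul_of_nonneg_left hK2 (Real.exp_pos _).le
    linarith only [h1, h2, h3, hBmass, hfar2]
  obtain ⟨k₀, hk₀B, hk₀M⟩ := hmeet
  rw [hBdef, mem_Ico] at hk₀B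
  -- hence `|m - M| < K s + s`
  have hmM : |((b : ℝ) + 1) - M| < K * s + s := by
    have h1 : ((b + 1 - (s - 1) : ℕ) : ℝ) ≤ k₀ := by exact_mod_cast hk₀B.1
    have h2 : (k₀ : ℝ) < (b : ℝ) + 1 + 1 := by exact_mod_cast hk₀B.2
    have h3 : ((b : ℝ) + 1) - (s - 1) ≤ ((b + 1 - (s - 1) : ℕ) : ℝ) := by
      rw [Nat.cast_sub hsb, Nat.cast_sub hsnat]; push_cast; linarith
    have h4 := (abs_lt.mp hk₀M).1
    have h5 := (abs_lt.mp hk₀M).2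
    have hKs0 : (0 : ℝ) ≤ (K : ℝ) * s := by positivity
    rw [abs_lt]
    constructor
    · linarith only [h2, h4, hs3]
    · linarith only [h1, h3, h5]
  -- (iv) the envelope from `m` reaches `n`: `|n - m| ≤ (K+1) s`, exponent `≤ E`
  have hnM := abs_le.mp hn
  have hnG : n ≤ G := by
    have : (n : ℝ) ≤ G := by linarith only [hnM.2, hMle, hG, hν]
    exact_mod_cast this
  have hnA : A ≤ n := by
    have : (A : ℝ) < (n : ℝ) + 1 := by linarith only [hnM.1, hMge, hA2, hinv, hν36]
    exact nat_le_of_lt_add_one this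
  have hexpo : ∀ j : ℕ, (j : ℝ) ≤ K * s + s →
      10 / ν * ((j : ℝ) * ((j : ℝ) + 1) / 2) ≤ E := by
    intro j hj
    have hj0 : (0 : ℝ) ≤ j := Nat.cast_nonneg j
    have hX1 : (1 : ℝ) ≤ ((K : ℝ) + 1) * s := by nlinarith only [hK1, hs3]
    have hjX : (j : ℝ) ≤ ((K : ℝ) + 1) * s := by linarith only [hj]
    have h1 : (j : ℝ) * ((j : ℝ) + 1) ≤ (((K : ℝ) + 1) * s) * ((((K : ℝ) + 1) * s) + 1) :=
      mul_le_mul hjX (by linarith only [hjX]) (by positivity) (by positivity)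
    have h2 : (((K : ℝ) + 1) * s) * ((((K : ℝ) + 1) * s) + 1) ≤ 2 * (((K : ℝ) + 1) * s) ^ 2 := by
      nlinarith only [hX1]
    have h3 : (j : ℝ) * ((j : ℝ) + 1) / 2 ≤ ((K : ℝ) + 1) ^ 2 * (s : ℝ) ^ 2 := by
      rw [div_le_iff₀ (by norm_num : (0 : ℝ) < 2)]
      have : 2 * (((K : ℝ) + 1) * s) ^ 2 = ((K : ℝ) + 1) ^ 2 * (s : ℝ) ^ 2 * 2 := by ring
      linarith only [h1, h2, this]
    calc 10 / ν * ((j : ℝ) * ((j : ℝ) + 1) / 2) ≤ 10 / ν * (((K : ℝ) + 1) ^ 2 * (s : ℝ) ^ 2) :=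
          mul_le_mul_of_nonneg_left h3 (by positivity)
      _ ≤ 10 / ν * (((K : ℝ) + 1) ^ 2 * (4 * ν)) := by gcongr
      _ = E := by rw [hEdef, div_mul_eq_mul_div, div_eq_iff hν.ne']; ring
  have hmain : p (b + 1) * Real.exp (-E) ≤ p n := by
    rcases le_or_gt (b + 1) n with hle | hlt
    · -- upward: `n = m + j`
      obtain ⟨j, rfl⟩ : ∃ j, n = b + 1 + j := ⟨n - (b + 1), by omega⟩
      have hj : (j : ℝ) ≤ K * s + s := by
        have h1 := (abs_lt.mp hmM).1
        push_cast at hnM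
        have h2 : (j : ℝ) < ((K * s + s : ℕ) : ℝ) + 1 := by push_cast; linarith only [h1, hnM.2]
        exact_mod_cast nat_le_of_lt_add_one h2
      have h := hup j (by omega)
      exact le_of_log_sub_ge (hpos _ (by omega)) hpm0 (le_trans (by linarith only [hexpo j hj]) h)
    · -- downward: `n + j = m`
      obtain ⟨j, hj⟩ : ∃ j, n + j = b + 1 := ⟨b + 1 - n, by omega⟩
      have hj' : (j : ℝ) ≤ K * s + s := by
        have h2 : (n : ℝ) + j = (b : ℝ) + 1 := by exact_mod_cast hj
        have h1 := (abs_lt.mp hmM).2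
        have h3 : (j : ℝ) < ((K * s + s : ℕ) : ℝ) + 1 := by push_cast; linarith only [h1, h2, hnM.1]
        exact_mod_cast nat_le_of_lt_add_one h3
      have h := hdown n j hnA hj
      exact le_of_log_sub_ge (hpos _ (by omega)) hpm0 (le_trans (by linarith only [hexpo j hj']) h)
  -- conclusion: `√ν p(n) ≥ √ν p(m) e^{-E} ≥ √ν e^{-E}/(10 s) ≥ e^{-E}/20`
  have hkey : (1 : ℝ) / 20 ≤ Real.sqrt ν * (1 / (10 * s)) := by
    rw [mul_one_div, div_le_div_iff₀ (by norm_num) (by positivity)]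
    linarith only [hs4]
  calc Real.exp (-E) / 20 = Real.exp (-E) * (1 / 20) := by ring
    _ ≤ Real.exp (-E) * (Real.sqrt ν * (1 / (10 * s))) :=
        mul_le_mul_of_nonneg_left hkey (Real.exp_pos _).le
    _ ≤ Real.exp (-E) * (Real.sqrt ν * p (b + 1)) := by gcongr
    _ = Real.sqrt ν * (p (b + 1) * Real.exp (-E)) := by ring
    _ ≤ Real.sqrt ν * p n := mul_le_mul_of_nonneg_left hmain (Real.sqrt_nonneg ν)

end

end Summit.AtomisticToContinuum.HydrodynamicLimit.Theorems.LightConeInLawSVC.CountLCLT
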